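import Summits.QuantumFields.QCD.Theorems.SpectralDefectExtinctionTipPricingSchurLatticeLocality
import Summits.QuantumFields.QCD.Theorems.SpectralDefectExtinctionTipPricingIndexEquiv
import Summits.QuantumFields.QCD.Theorems.SpectralDefectExtinctionTipPricingAbstractTemplate
import Summits.QuantumFields.QCD.Theorems.SpectralDefectExtinctionTipPricingWallBlockGapHalfFlux
import Summits.QuantumFields.QCD.Theorems.SpectralDefectExtinctionTipPricingSchurGap
import Summits.QuantumFields.QCD.Theorems.SpectralDefectExtinctionTipPricingInertiaHaynsworth
import Summits.QuantumFields.QCD.Theorems.SpectralDefectExtinctionTipPricingBoxBlockIndexAux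
import Summits.QuantumFields.QCD.Theorems.SpectralDefectExtinctionTipPricingBoxBlockIndexAux2

/-!
# Index of a tiled box (sub-goal ASM1 of the modular cell–wall template, crux stmt-QuantumFields-8967)

Deterministic spectral core of the modular cell–wall template (crux idea `Cruxes/TipPricing/Ideas/modular-cell-wall-template.md`,
lead c2; serves stub `stub_spreadOfCells` of line `hermitian-flow-coarea` r3 for crux
`Summit.QuantumFields.QCD.Theses.SpectralDefectExtinction.TipPricing`).  For `H = Γ₅ (D_W(U) − δ)` on the torus `ℤ_n⁴` and a
big box `c + {−R..R}⁴` (`2R+1 < n`) tiled exactly by `N` cells-with-collars `z k + {−(ℓ+W)..ℓ+W}⁴` (`W ≥ 2`): if every link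
based off the cell cores is `η`-close to the centre-flux pattern, every cell-with-collar block of `H` has the norm gap `g` and
at least `6(2(ℓ+W)+1)⁴ + e` negative eigenvalues, `0 < g₁ ≤ 3/8 − δ − 12η` and the Schur-locality error `ε(R, W, g₁) < g`, then
the big-box block of `H` is invertible with at least `6(2R+1)⁴ + N·e` negative eigenvalues (`boxBlock_index_of_cells`).

Proof.  Re-index the big-box block as `[[H_cells, B],[Bᴴ, H_wall]]` (`boxIdx_equiv_cells_sum_wall`) and every
cell-with-collar block as `[[H_cell, B_k],[B_kᴴ, H_collar]]` (`cwcIdx_equiv_cell_sum_collar`).  The wall and collar blocks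
have the gap `(3/8 − δ − 12η)² ≥ g₁²`, inertia exactly half and are invertible (`wallFacts`, `collarFacts`, from
`wallBlock_gap_and_half`); distinct cell cores, and a cell core and a foreign collar, are decoupled (`cellCore_entry_eq_zero`),
so `H_cells` is block diagonal and the lattice Schur locality (`schur_lattice_locality`) bounds the difference between the
wall Schur correction and the block diagonal of the per-collar corrections by `ε`.  The abstract assembly
(`boxBlock_abstract_assembly`: abstract template + Haynsworth + Schur gap) then gives `det ≠ 0` and
`n₋(box) + Σ_k n₋(collar k) = n₋(wall) + Σ_k n₋(cwc k)`; with `n₋(wall) = 6·#wall`, `n₋(collar k) = 6·#collar k`,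
`n₋(cwc k) ≥ 6(2(ℓ+W)+1)⁴ + e` and the site counts `(2R+1)⁴ = N(2ℓ+1)⁴ + #wall`, `(2(ℓ+W)+1)⁴ = (2ℓ+1)⁴ + #collar k`
(`card_wallSites`, `card_collarSites`) the bound follows.  Supports stmt-QuantumFields-8967 (stub `boxBlock_index_of_cells`,
ASM1, of line `hermitian-flow-coarea`).
-/

noncomputable section

namespace Summit.QuantumFields.QCD.Cruxes.TipPricing.ModularTemplate

open Matrix
open Literature.MathematicalPhysics.QuantumLattice Literature.MathematicalPhysics.QuantumFieldTheory
  Literature.Probability.LatticeModels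
open Summit.QuantumFields.QCD.Theorems.ExtinctionBuildsQCD.Negative
open scoped BigOperators

variable {n : ℕ} [NeZero n]

/-- **ASM1. Index of a tiled box.**  Big box `{−R..R}⁴` about `c` (`2R+1 < n`) tiled exactly by `N` cells-with-collars
`z k + {−(ℓ+W)..ℓ+W}⁴` (`hin`, `hdisj`, `hcover`), `W ≥ 2`, centres in `3ℤ⁴`.  If every wall link (base site outside all cells) is
entrywise `η`-close to the centre-flux pattern, every cell-with-collar block of `H = Γ₅(D_W(U) − δ)` has norm gap `g` and at least
`6(2(ℓ+W)+1)⁴ + e` negative eigenvalues, `0 ≤ δ`, `0 < g₁ ≤ 3/8 − δ − 12η`, and the Schur-locality error at `(R, W, g₁)` is `< g`,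
then the big-box block is invertible with at least `6(2R+1)⁴ + N·e` negative eigenvalues. -/
theorem boxBlock_index_of_cells (U : GaugeConfig 4 n SU3) (c : Fin 4 → ℤ) (ℓ W R N e : ℕ) (hW : 2 ≤ W)
    (hR : 2 * R + 1 < n) (z : Fin N → (Fin 4 → ℤ))
    (hin : ∀ k, ∀ (y : Fin 4 → ℤ), y ∈ box 4 (ℓ + W) → z k + y ∈ box 4 R)
    (hdisj : ∀ k k', k ≠ k' → ∀ (y y' : Fin 4 → ℤ), y ∈ box 4 (ℓ + W) → y' ∈ box 4 (ℓ + W) → z k + y ≠ z k' + y')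
    (hcover : ∀ (x : Fin 4 → ℤ), x ∈ box 4 R → ∃ (k : Fin N) (y : Fin 4 → ℤ), y ∈ box 4 (ℓ + W) ∧ x = z k + y)
    (h3 : ∀ (k : Fin N) (i : Fin 4), (3 : ℤ) ∣ z k i)
    (δ η g g₁ : ℝ) (hδ : 0 ≤ δ) (hη : 0 ≤ η) (hg : 0 < g) (hg₁ : 0 < g₁) (hg₁le : g₁ ≤ 3 / 8 - δ - 12 * η)
    (hflux : ∀ (x : Fin 4 → ℤ), x ∈ box 4 R → (¬ ∃ (k : Fin N) (y : Fin 4 → ℤ), y ∈ box 4 ℓ ∧ x = z k + y) →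
      ∀ (μ : Fin 4) (i j : Fin 3),
        ‖(↑(U (Torus.proj n (c + x), μ)) : Matrix (Fin 3) (Fin 3) ℂ) i j -
            (if i = j then
              (if μ = 1 then Complex.exp (2 * Real.pi * Complex.I * ((x 0 : ℤ) : ℂ) / 3)
               else if μ = 3 then Complex.exp (2 * Real.pi * Complex.I * ((x 2 : ℤ) : ℂ) / 3) else 1)
             else 0)‖ ≤ η)
    (hcell : ∀ k : Fin N,
      (∀ v : {p : TorusSite 4 n × Fin 3 × Fin 4 //
          ∃ (y : ↥(box 4 (ℓ + W))), Torus.proj n (c + z k + (y : Fin 4 → ℤ)) = p.1} → ℂ,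
        g ^ 2 * ∑ i, ‖v i‖ ^ 2 ≤
          ∑ i, ‖(((spinorLift gammaFive * wilsonDirac (fundamentalRep (Fin 3)) U (-δ) 1).submatrix
            (Subtype.val : {p : TorusSite 4 n × Fin 3 × Fin 4 //
              ∃ (y : ↥(box 4 (ℓ + W))), Torus.proj n (c + z k + (y : Fin 4 → ℤ)) = p.1} → _) Subtype.val) *ᵥ v) i‖ ^ 2) ∧
      6 * (2 * (ℓ + W) + 1) ^ 4 + e ≤
        negRootCount ((spinorLift gammaFive * wilsonDirac (fundamentalRep (Fin 3)) U (-δ) 1).submatrix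
          (Subtype.val : {p : TorusSite 4 n × Fin 3 × Fin 4 //
            ∃ (y : ↥(box 4 (ℓ + W))), Torus.proj n (c + z k + (y : Fin 4 → ℤ)) = p.1} → _) Subtype.val))
    (hε : 12 * (2 * (R : ℝ) + 1) ^ 4 * (96 * (2 / g₁) * (12 * (2 * (R : ℝ) + 1) ^ 4 * 96) *
          (2 / g₁ * Real.exp (-(g₁ / 400 * ((W : ℝ) - 1)))) * 96) < g) :
    ((spinorLift gammaFive * wilsonDirac (fundamentalRep (Fin 3)) U (-δ) 1).submatrix
        (Subtype.val : {p : TorusSite 4 n × Fin 3 × Fin 4 //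
          ∃ (y : ↥(box 4 R)), Torus.proj n (c + (y : Fin 4 → ℤ)) = p.1} → _) Subtype.val).det ≠ 0 ∧
    6 * (2 * R + 1) ^ 4 + N * e ≤
      negRootCount ((spinorLift gammaFive * wilsonDirac (fundamentalRep (Fin 3)) U (-δ) 1).submatrix
        (Subtype.val : {p : TorusSite 4 n × Fin 3 × Fin 4 //
          ∃ (y : ↥(box 4 R)), Torus.proj n (c + (y : Fin 4 → ℤ)) = p.1} → _) Subtype.val) := by
  have _ := h3
  have _ := hg
  ---- constants
  have hW1 : 1 ≤ W := le_trans (by norm_num) hW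
  have hδ' : δ + 12 * η < 3 / 8 := by linarith
  have hg₁1 : g₁ ≤ 1 := by linarith
  have hmono : box 4 ℓ ⊆ box 4 (ℓ + W) := box_mono 4 (Nat.le_add_right ℓ W)
  have hρ : ∀ g : SU3, fundamentalRep (Fin 3) g ∈ Matrix.unitaryGroup (Fin 3) ℂ := fundamentalRep_mem_unitaryGroup
  have hHerm : (spinorLift gammaFive * wilsonDirac (fundamentalRep (Fin 3)) U (-δ) 1).IsHermitian :=
    Literature.Barriers.QuantumFields.isHermitian_gammaFive_mul_wilsonDirac _ hρ U (-δ) 1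
  ---- index equivalences: big box = cells ⊕ wall, cell-with-collar = cell ⊕ collar, cells ≃ cell index subtype
  obtain ⟨e, he₁, he₂⟩ := boxIdx_equiv_cells_sum_wall (n := n) c ℓ R N hR z (fun k y hy => hin k y (hmono hy))
    fun k k' hk y y' hy hy' => hdisj k k' hk y y' (hmono hy) (hmono hy')
  have hside := cwc_side_lt ℓ W R N hR z hin
  choose ek hek₁ hek₂ using fun k : Fin N => cwcIdx_equiv_cell_sum_collar (n := n) c (z k) ℓ W (hside k)
  obtain ⟨σ, hσ⟩ := cellIdx_equiv (n := n) c ℓ W R N hR z hin hdisj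
  ---- analytic inputs: wall and collar blocks, lattice Schur locality
  have hwall := wallFacts U c ℓ R N hR z η δ hη hδ' hflux
  have hcollar := collarFacts U c ℓ W R N hR z hin hdisj η δ hη hδ' hflux
  have hsq : g₁ ^ 2 ≤ (3 / 8 - δ - 12 * η) ^ 2 := pow_le_pow_left₀ hg₁.le hg₁le 2
  have hloc := schur_lattice_locality U c ℓ W R N hW hR z hin hdisj hcover δ g₁ hg₁ hg₁1
    (fun v => (mul_le_mul_of_nonneg_right hsq (Finset.sum_nonneg fun i _ => by positivity)).trans (hwall.1 v))
    (fun k v => (mul_le_mul_of_nonneg_right hsq (Finset.sum_nonneg fun i _ => by positivity)).trans ((hcollar k).1 v))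
  ---- decoupling of cell cores from foreign cells-with-collars
  have hoff : ∀ q q' : (↥(box 4 ℓ) × Fin 3 × Fin 4) × Fin N, q.2 ≠ q'.2 →
      (spinorLift gammaFive * wilsonDirac (fundamentalRep (Fin 3)) U (-δ) 1 :
        Matrix (TorusSite 4 n × Fin 3 × Fin 4) (TorusSite 4 n × Fin 3 × Fin 4) ℂ)
        (Torus.proj n (c + z q.2 + (q.1.1 : Fin 4 → ℤ)), q.1.2.1, q.1.2.2)
        (Torus.proj n (c + z q'.2 + (q'.1.1 : Fin 4 → ℤ)), q'.1.2.1, q'.1.2.2) = 0 :=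
    fun q q' hq => cellCore_entry_eq_zero U δ c hW1 hR z hin hdisj hq q.1.1.2 (hmono q'.1.1.2) rfl rfl
  have hoffC : ∀ (q : (↥(box 4 ℓ) × Fin 3 × Fin 4) × Fin N) (k : Fin N)
      (i : {p : TorusSite 4 n × Fin 3 × Fin 4 //
        (∃ (y : ↥(box 4 (ℓ + W))), Torus.proj n (c + z k + (y : Fin 4 → ℤ)) = p.1) ∧
        ¬ ∃ (y : ↥(box 4 ℓ)), Torus.proj n (c + z k + (y : Fin 4 → ℤ)) = p.1}), q.2 ≠ k →
      (spinorLift gammaFive * wilsonDirac (fundamentalRep (Fin 3)) U (-δ) 1 :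
        Matrix (TorusSite 4 n × Fin 3 × Fin 4) (TorusSite 4 n × Fin 3 × Fin 4) ℂ)
        (Torus.proj n (c + z q.2 + (q.1.1 : Fin 4 → ℤ)), q.1.2.1, q.1.2.2) i.1 = 0 := by
    rintro q k ⟨i, ⟨⟨y₂, hy₂⟩, hi⟩, -⟩ hk
    exact cellCore_entry_eq_zero U δ c hW1 hR z hin hdisj hk q.1.1.2 hy₂ rfl hi.symm
  ---- the abstract assembly
  have hε0 : 0 ≤ 12 * (2 * (R : ℝ) + 1) ^ 4 * (96 * (2 / g₁) * (12 * (2 * (R : ℝ) + 1) ^ 4 * 96) *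
      (2 / g₁ * Real.exp (-(g₁ / 400 * ((W : ℝ) - 1)))) * 96) := by positivity
  obtain ⟨hdet, hcount⟩ := boxBlock_abstract_assembly (spinorLift gammaFive * wilsonDirac (fundamentalRep (Fin 3)) U (-δ) 1)
    hHerm (fun q : (↥(box 4 ℓ) × Fin 3 × Fin 4) × Fin N => (Torus.proj n (c + z q.2 + (q.1.1 : Fin 4 → ℤ)), q.1.2.1, q.1.2.2))
    Subtype.val Subtype.val Subtype.val
    (fun k : Fin N => (Subtype.val : {p : TorusSite 4 n × Fin 3 × Fin 4 //
      (∃ (y : ↥(box 4 (ℓ + W))), Torus.proj n (c + z k + (y : Fin 4 → ℤ)) = p.1) ∧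
      ¬ ∃ (y : ↥(box 4 ℓ)), Torus.proj n (c + z k + (y : Fin 4 → ℤ)) = p.1} → _))
    (fun k : Fin N => (Subtype.val : {p : TorusSite 4 n × Fin 3 × Fin 4 //
      ∃ (y : ↥(box 4 (ℓ + W))), Torus.proj n (c + z k + (y : Fin 4 → ℤ)) = p.1} → _))
    e he₁ he₂ ek hek₁ hek₂ σ hσ hoff hoffC hwall.2.2 (fun k => (hcollar k).2.2) hε0 hε (fun k => (hcell k).1) hloc
  refine ⟨hdet, ?_⟩
  ---- counting
  have hcW := card_wallSites (n := n) c ℓ W R N hR z hin hdisj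
  have hcCo := card_collarSites (n := n) c ℓ W R N hR z hin
  have h1 := Finset.sum_congr rfl fun (k : Fin N) (_ : k ∈ Finset.univ) => (hcollar k).2.1
  have h2 := Finset.sum_le_sum fun (k : Fin N) (_ : k ∈ Finset.univ) => (hcell k).2
  rw [Finset.sum_const, Finset.card_univ, Fintype.card_fin, smul_eq_mul] at h2
  have h4 : ∑ k : Fin N, 6 * Fintype.card {x : TorusSite 4 n //
        (∃ (y : ↥(box 4 (ℓ + W))), Torus.proj n (c + z k + (y : Fin 4 → ℤ)) = x) ∧
        ¬ ∃ (y : ↥(box 4 ℓ)), Torus.proj n (c + z k + (y : Fin 4 → ℤ)) = x} + N * (6 * (2 * ℓ + 1) ^ 4) =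
      N * (6 * (2 * (ℓ + W) + 1) ^ 4) := by
    have hc : ∀ a : ℕ, N * a = ∑ _k : Fin N, a := fun a => by
      rw [Finset.sum_const, Finset.card_univ, Fintype.card_fin, smul_eq_mul]
    rw [hc, hc, ← Finset.sum_add_distrib]
    exact Finset.sum_congr rfl fun k _ => by have := hcCo k; omega
  rw [hwall.2.1, h1] at hcount
  linarith

end Summit.QuantumFields.QCD.Cruxes.TipPricing.ModularTemplate

end
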